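import Summits.QuantumFields.BalabanUV.Beta.GAN24.CapacitanceClosedForm

/-!
# `BalabanUV.Beta.GAN24.CapacitanceClosedFormScaling` — binder row G-an2-4 / (CONV-C), road P1-fibre, crux A4/A5 of `SKELETON-P1.md` (typer row P1-Y08f, part 5):
# the `L₀`-REGULARISED closed form — the inverse capacitance blocks carry the factors `L₀`, `L₀²` EXPLICITLY, so they extend across the complex cone `L₀ = 0`

NOT IN PRINT; OUR PROOF ATTEMPT.  HONEST FRAMING (cell contract, verbatim): «discharging `BetaPertH` makes Bałaban's UV stability UNCONDITIONAL — a real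
constructive-QFT result; it is NOT the continuum limit and NOT the Clay problem.»  HONEST DEPENDENCY (verbatim): «continuum YM on T⁴ ⇐ BetaPertH ∧ nine spine
estimates (0/9 proved); BetaPertH ⇐ (D1) ∧ (D4) ∧ CAP+tail; G-an2-4 gates asym, D1 and NE2/3/4.»  [folklore] rational identities over `ℂ` (no estimate, no cited
fact, no wall binder, no `def … : Prop` hypothesis).  NOT summit progress; nothing of (CONV-C)'s K-slot is discharged here.

## What is proved
In `GAN24/CapacitanceClosedForm` the inverse blocks `invPP/invPc/invcP/invcc` are rational in the scalars `a_κ`, `σ`, `h = hSum a δ δ'`.  On the alias fibre the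
`m = 0` summands of `a_κ` and `σ` carry `1/L₀` and `1/L₀²` (`L₀ = lapSym (p/N)`), which vanish on the complex cone inside every strip (leaf-03-g5's cone
probe, journal 2026-08-20T00:00Z) — so bounds through `a_κ`, `σ` themselves cannot cross the cone.  THIS FILE records the exact SCALING LAWS that remove the
issue: writing `a_κ = ã_κ/L`, `σ = σ̃/L²` (so that on the alias fibre `ã_κ = w₀ s_κ s♭_κ/2 + L₀·a′_κ`, `σ̃ = w₀ + L₀²·σ′` are POLE-FREE — entire in `p`),
* `hSum_div : hSum (ã/L) δ δ' = L · hSum ã δ δ'` (so `h = L₀·g`, `g := hSum ã δ δ'` pole-free);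
* `invPP_div : invPP (ã/L) δ δ' κ l = L · invPP ã δ δ' κ l`;
* `invPc_div : invPc (ã/L) δ δ' (σ̃/L²) κ = L² · invPc ã δ δ' σ̃ κ`, `invcP_div` likewise;
* `invcc_div : invcc (ã/L) δ δ' (σ̃/L²) = L²/(2σ̃) − L³/(σ̃²·hSum ã δ δ')`
(for `L ≠ 0`; the last needs `σ̃ ≠ 0`, `hSum ã ≠ 0`).  Hence `(Cap⁻¹)_φφ = L₀·(rational in ã, g)`, `(Cap⁻¹)_φc,cφ,cc = L₀²·(rational in ã, σ̃, g)` with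
denominators `ã_κ`, `σ̃`, `g` only: the closed form is analytic across `{L₀ = 0}` and its singular set on a strip is `{ã_κ = 0} ∪ {σ̃ = 0} ∪ {g = 0}`.  On the
real zone this is also the cheapest way to read off the `p → 0` orders of A4′(iii) (`L₀ ≍ |p|²/N²`).  A cut of p1's L10 (strip) through these regularised scalars
is a typer/gan24-p1 decision; this file only supplies the algebra.
-/

open Finset
open scoped BigOperators

namespace Summit.QuantumFields.BalabanUV.Beta.GAN24.CapacitanceClosedFormScaling

open CapacitanceClosedForm (hSum invPP invPc invcP invcc)

variable {D : ℕ}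

/-- [folklore] **`h` SCALES BY `L`**: `hSum (ã/L) δ δ' = L · hSum ã δ δ'` (unconditional rational identity). -/
theorem hSum_div (at_ δ δ' : Fin D → ℂ) (L : ℂ) :
    hSum (fun κ => at_ κ / L) δ δ' = L * hSum at_ δ δ' := by
  unfold hSum
  rw [Finset.mul_sum]
  refine Finset.sum_congr rfl fun κ _ => ?_
  rw [div_div_eq_mul_div]
  ring

/-- [folklore] **THE `φφ` BLOCK CARRIES ONE FACTOR `L`**: `invPP (ã/L) δ δ' κ l = L · invPP ã δ δ' κ l` (`L ≠ 0`). -/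
theorem invPP_div (at_ δ δ' : Fin D → ℂ) {L : ℂ} (hL : L ≠ 0) (κ l : Fin D) :
    invPP (fun κ => at_ κ / L) δ δ' κ l = L * invPP at_ δ δ' κ l := by
  unfold invPP
  rw [hSum_div]
  have e1 : (if κ = l then 1 / (at_ κ / L) else (0 : ℂ)) = L * (if κ = l then 1 / at_ κ else 0) := by
    split_ifs
    · rw [one_div, one_div, inv_div]; ring
    · ring
  have e2 : δ κ * δ' l / (at_ κ / L * (at_ l / L) * (L * hSum at_ δ δ')) = L * (δ κ * δ' l / (at_ κ * at_ l * hSum at_ δ δ')) := by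
    rw [div_mul_div_comm, show at_ κ * at_ l / (L * L) * (L * hSum at_ δ δ') = (at_ κ * at_ l * hSum at_ δ δ') / L by
      rw [div_mul_eq_mul_div, mul_comm L (hSum at_ δ δ'), ← mul_assoc, ← div_div, mul_div_assoc, mul_div_assoc,
        div_self hL, mul_one_div]]
    rw [div_div_eq_mul_div]
    ring
  rw [e1, e2, mul_sub]

/-- [folklore] **THE `φc` COLUMN CARRIES `L²`**: `invPc (ã/L) δ δ' (σ̃/L²) κ = L² · invPc ã δ δ' σ̃ κ` (`L ≠ 0`). -/
theorem invPc_div (at_ δ δ' : Fin D → ℂ) (st : ℂ) {L : ℂ} (hL : L ≠ 0) (κ : Fin D) :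
    invPc (fun κ => at_ κ / L) δ δ' (st / L ^ 2) κ = L ^ 2 * invPc at_ δ δ' st κ := by
  unfold invPc
  rw [hSum_div, show at_ κ / L * (st / L ^ 2) * (L * hSum at_ δ δ') = (at_ κ * st * hSum at_ δ δ') / L ^ 2 by
    field_simp]
  rw [div_div_eq_mul_div]
  ring

/-- [folklore] **THE `cφ` ROW CARRIES `L²`**: `invcP (ã/L) δ δ' (σ̃/L²) l = L² · invcP ã δ δ' σ̃ l` (`L ≠ 0`). -/
theorem invcP_div (at_ δ δ' : Fin D → ℂ) (st : ℂ) {L : ℂ} (hL : L ≠ 0) (l : Fin D) :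
    invcP (fun κ => at_ κ / L) δ δ' (st / L ^ 2) l = L ^ 2 * invcP at_ δ δ' st l := by
  unfold invcP
  rw [hSum_div, show at_ l / L * (st / L ^ 2) * (L * hSum at_ δ δ') = (at_ l * st * hSum at_ δ δ') / L ^ 2 by
    field_simp]
  rw [div_div_eq_mul_div]
  ring

/-- [folklore] **THE `cc` CORNER CARRIES `L²` AND `L³`**: `invcc (ã/L) δ δ' (σ̃/L²) = L²/(2σ̃) − L³/(σ̃²·hSum ã δ δ')` (`L, σ̃, hSum ã ≠ 0`). -/
theorem invcc_div (at_ δ δ' : Fin D → ℂ) {st L : ℂ} (hL : L ≠ 0) (hst : st ≠ 0) (hg : hSum at_ δ δ' ≠ 0) :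
    invcc (fun κ => at_ κ / L) δ δ' (st / L ^ 2) = L ^ 2 / (2 * st) - L ^ 3 / (st ^ 2 * hSum at_ δ δ') := by
  unfold invcc
  rw [hSum_div]
  field_simp

/-- [folklore] The `cc` corner in CANCELLATION form with the regularised scalars: `invcc (ã/L) δ δ' (σ̃/L²) = L²·(σ̃·g − 2L)/(2σ̃²g)`, `g = hSum ã δ δ'`
— it vanishes to order `L²` at `L = 0` with the finite limit coefficient `1/(2σ̃)`. -/
theorem invcc_div_cancel (at_ δ δ' : Fin D → ℂ) {st L : ℂ} (hL : L ≠ 0) (hst : st ≠ 0) (hg : hSum at_ δ δ' ≠ 0) :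
    invcc (fun κ => at_ κ / L) δ δ' (st / L ^ 2) = L ^ 2 * (st * hSum at_ δ δ' - 2 * L) / (2 * st ^ 2 * hSum at_ δ δ') := by
  rw [invcc_div at_ δ δ' hL hst hg]
  field_simp

/-! ## Norm forms: bounds through the regularised scalars -/

/-- [folklore] `‖(Cap⁻¹)_φφ κ l‖ ≤ ‖L‖·(α̃ + α̃²ε²η̃)` from `‖ã⁻¹‖ ≤ α̃`, `‖δ‖,‖δ'‖ ≤ ε`, `‖g⁻¹‖ ≤ η̃` — no `1/L` anywhere. -/
theorem norm_invPP_div_le (at_ δ δ' : Fin D → ℂ) {L : ℂ} (hL : L ≠ 0) {α ε η : ℝ} (hα : ∀ κ, ‖(at_ κ)⁻¹‖ ≤ α)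
    (hε : ∀ κ, ‖δ κ‖ ≤ ε) (hε' : ∀ κ, ‖δ' κ‖ ≤ ε) (hη : ‖(hSum at_ δ δ')⁻¹‖ ≤ η) (κ l : Fin D) :
    ‖invPP (fun κ => at_ κ / L) δ δ' κ l‖ ≤ ‖L‖ * (α + α ^ 2 * ε ^ 2 * η) := by
  rw [invPP_div at_ δ δ' hL, norm_mul]
  exact mul_le_mul_of_nonneg_left (CapacitanceClosedForm.norm_invPP_le at_ δ δ' hα hε hε' hη κ l) (norm_nonneg _)

/-- [folklore] `‖(Cap⁻¹)_φc κ‖ ≤ ‖L‖²·α̃ες̃η̃` from the regularised data (`‖σ̃⁻¹‖ ≤ ς̃`). -/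
theorem norm_invPc_div_le (at_ δ δ' : Fin D → ℂ) (st : ℂ) {L : ℂ} (hL : L ≠ 0) {α ε ς η : ℝ} (hα : ∀ κ, ‖(at_ κ)⁻¹‖ ≤ α)
    (hε : ∀ κ, ‖δ κ‖ ≤ ε) (hς : ‖st⁻¹‖ ≤ ς) (hη : ‖(hSum at_ δ δ')⁻¹‖ ≤ η) (κ : Fin D) :
    ‖invPc (fun κ => at_ κ / L) δ δ' (st / L ^ 2) κ‖ ≤ ‖L‖ ^ 2 * (α * ε * ς * η) := by
  rw [invPc_div at_ δ δ' st hL, norm_mul, norm_pow]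
  exact mul_le_mul_of_nonneg_left (CapacitanceClosedForm.norm_invPc_le at_ δ δ' st hα hε hς hη κ) (pow_nonneg (norm_nonneg _) 2)

/-- [folklore] `‖(Cap⁻¹)_cφ l‖ ≤ ‖L‖²·α̃ες̃η̃` from the regularised data. -/
theorem norm_invcP_div_le (at_ δ δ' : Fin D → ℂ) (st : ℂ) {L : ℂ} (hL : L ≠ 0) {α ε ς η : ℝ} (hα : ∀ κ, ‖(at_ κ)⁻¹‖ ≤ α)
    (hε' : ∀ κ, ‖δ' κ‖ ≤ ε) (hς : ‖st⁻¹‖ ≤ ς) (hη : ‖(hSum at_ δ δ')⁻¹‖ ≤ η) (l : Fin D) :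
    ‖invcP (fun κ => at_ κ / L) δ δ' (st / L ^ 2) l‖ ≤ ‖L‖ ^ 2 * (α * ε * ς * η) := by
  rw [invcP_div at_ δ δ' st hL, norm_mul, norm_pow]
  exact mul_le_mul_of_nonneg_left (CapacitanceClosedForm.norm_invcP_le at_ δ δ' st hα hε' hς hη l) (pow_nonneg (norm_nonneg _) 2)

end Summit.QuantumFields.BalabanUV.Beta.GAN24.CapacitanceClosedFormScaling
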